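import Summits.CriticalPhenomena.SAWScalingLimit.Theorems.SAWDefectDecoherenceObservableToSLERTwoPieceAdmIdentificationLaw
import HarnessLib

/-!
# Crux `SAWDefectDecoherence.ObservableToSLER` (stmt-CriticalPhenomena-14005), line
`bridge-gate-renewal` (r7), stub 5a3 `stub_twoPieceAdmIdentification`: what weak limits of the
Duminil-Copin–Smirnov laws inherit — endpoints, confinement, simplicity

Landing target:
`Summits/CriticalPhenomena/SAWScalingLimit/Theorems/SAWDefectDecoherenceObservableToSLERTwoPieceAdmIdentificationLimits.lean`
(`--supports stmt-CriticalPhenomena-14005`).  Sequel of `…TwoPieceAdmIdentificationLaw` (the DCS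
law on mid-edge walks as a measure on curve classes; portmanteau along a sequence of meshes).

* `source_latticeCurve`, `target_latticeCurve`, `mem_range_latticeCurve`,
  `range_latticeCurve_subset` — the rescaled polyline of a vertex list: endpoints, the centres lie
  on it, and its trace lies within `δ` of its centres;
* `ae_source_eq_of_ratio` / `ae_target_eq_of_ratio` (endpoints of the limit classes),
  `ae_range_subset_closure_of_ratio` (confinement), `ae_mem_simple_of_ratio` (SIMPLICITY from a
  uniform injectivity modulus along the sequence; port of
  `FloorRatio.ae_mem_simple_of_uniformModulus`, p76439).
-/

noncomputable section

open scoped BigOperators Topology NNReal ENNReal BoundedContinuousFunction Classical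
open Filter Set MeasureTheory Metric
open Literature.Probability.LatticeModels (HexVertex hexGraph hexCenter polyline)
open Literature.Probability.RandomPlanarGeometry
open Literature.Probability.RandomPlanarGeometry.SAW

namespace Summit.CriticalPhenomena.SAWScalingLimit.Theorems.ObservableToSLER.TwoPiece

/-! ### The rescaled polyline of a vertex list -/

section Polyline

/-- The trace of a polyline whose consecutive points are `δ`-close lies within `δ` of its
points. [folklore] -/
theorem range_polylineFrom_subset_cthickening {δ : ℝ} {S : Set ℂ} :
    ∀ (x : ℂ) (l : List ℂ), (x :: l).IsChain (fun u w => dist u w ≤ δ) → (∀ y ∈ x :: l, y ∈ S) →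
      Set.range (Literature.Probability.LatticeModels.polylineFrom x l).2 ⊆ cthickening δ S
  | x, [], _, hS => by
    rw [Literature.Probability.LatticeModels.polylineFrom_nil]
    rintro _ ⟨t, rfl⟩
    exact self_subset_cthickening _ (hS x (by simp))
  | x, y :: l, hc, hS => by
    rw [Literature.Probability.LatticeModels.polylineFrom_cons]
    change Set.range ((Path.segment x y).trans
      (Literature.Probability.LatticeModels.polylineFrom y l).2) ⊆ _
    rw [Path.trans_range, Path.range_segment]
    rw [List.isChain_cons_cons] at hc
    refine union_subset ?_ (range_polylineFrom_subset_cthickening y l hc.2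
      fun z hz => hS z (List.mem_cons_of_mem _ hz))
    intro z hz
    have hzx : dist z x ≤ δ := by
      have := segment_subset_closedBall_left x y hz
      rw [mem_closedBall] at this
      exact this.trans hc.1
    exact mem_cthickening_of_dist_le z x δ S (hS x (by simp)) hzx

/-- A nonempty lattice curve starts at the first rescaled centre. [folklore] -/
theorem source_latticeCurve {δ : ℝ} {l : List HexVertex} (hl : l ≠ []) :
    (CurveClass.mk ⟨polyline (l.map fun v => ((δ : ℝ) : ℂ) * hexCenter v)⟩).source = (δ : ℂ) * hexCenter (l.head hl) := by
  obtain ⟨v, l, rfl⟩ := List.exists_cons_of_ne_nil hl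
  rw [CurveClass.source_mk]
  show polyline (List.map (fun v => (δ : ℂ) * hexCenter v) (v :: l)) 0 = _
  rw [List.map_cons, Literature.Probability.LatticeModels.polyline_apply_zero]
  rfl

/-- A nonempty lattice curve ends at the last rescaled centre. [folklore] -/
theorem target_latticeCurve {δ : ℝ} {l : List HexVertex} (hl : l ≠ []) :
    (CurveClass.mk ⟨polyline (l.map fun v => ((δ : ℝ) : ℂ) * hexCenter v)⟩).target = (δ : ℂ) * hexCenter (l.getLast hl) := by
  rw [CurveClass.target_mk]
  have hl' : l.map (fun v => (δ : ℂ) * hexCenter v) ≠ [] := by simpa using hl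
  show polyline (List.map (fun v => (δ : ℂ) * hexCenter v) l) 1 = _
  obtain ⟨v, l, rfl⟩ := List.exists_cons_of_ne_nil hl
  rw [← List.getLast_map (f := fun v => (δ : ℂ) * hexCenter v) hl']
  simp only [List.map_cons]
  exact Literature.Probability.LatticeModels.polyline_apply_one _ _

/-- Every rescaled centre of the list lies on the lattice curve. [folklore] -/
theorem mem_range_latticeCurve {δ : ℝ} {l : List HexVertex} {v : HexVertex} (hv : v ∈ l) :
    (δ : ℂ) * hexCenter v ∈ (CurveClass.mk ⟨polyline (l.map fun v => ((δ : ℝ) : ℂ) * hexCenter v)⟩).range := by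
  obtain ⟨w, l, rfl⟩ := List.exists_cons_of_ne_nil (List.ne_nil_of_mem hv)
  rw [CurveClass.range_mk]
  show _ ∈ Set.range (polyline (List.map (fun v => (δ : ℂ) * hexCenter v) (w :: l)))
  simp only [List.map_cons]
  refine Literature.Probability.LatticeModels.mem_range_polylineFrom _ _ ?_
  have := List.mem_map_of_mem (f := fun v => (δ : ℂ) * hexCenter v) hv
  simpa only [List.map_cons] using this

/-- **The trace of a lattice curve is controlled by its centres**: if consecutive vertices of the
list are at rescaled distance `≤ δ` (e.g. honeycomb neighbours, distance `δ/√3`), the trace lies in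
the closed `δ`-neighbourhood of any set containing the rescaled centres of the list. [folklore] -/
theorem range_latticeCurve_subset {δ : ℝ} {l : List HexVertex}
    (hchain : l.IsChain fun u w => dist ((δ : ℂ) * hexCenter u) ((δ : ℂ) * hexCenter w) ≤ δ)
    {S : Set ℂ} (hS : ∀ v ∈ l, (δ : ℂ) * hexCenter v ∈ S) (hl : l ≠ []) :
    (CurveClass.mk ⟨polyline (l.map fun v => ((δ : ℝ) : ℂ) * hexCenter v)⟩).range ⊆ cthickening δ S := by
  obtain ⟨w, l, rfl⟩ := List.exists_cons_of_ne_nil hl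
  rw [CurveClass.range_mk]
  show Set.range (polyline (List.map (fun v => (δ : ℂ) * hexCenter v) (w :: l))) ⊆ _
  simp only [List.map_cons]
  have h1 : ((w :: l).map fun v => (δ : ℂ) * hexCenter v).IsChain (fun u w => dist u w ≤ δ) :=
    List.isChain_map_of_isChain (fun v => (δ : ℂ) * hexCenter v) (fun _ _ h => h) hchain
  have h2 : ∀ y ∈ (w :: l).map (fun v => (δ : ℂ) * hexCenter v), y ∈ S := by
    intro y hy
    rw [List.mem_map] at hy
    obtain ⟨v, hv, rfl⟩ := hy
    exact hS v hv
  exact range_polylineFrom_subset_cthickening _ _ h1 h2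

end Polyline

/-! ### What the weak limits inherit: endpoints, confinement, simplicity -/

section Consequences

variable {Λ : ℝ → Finset HexVertex} {a b : ℝ → Sym2 HexVertex} {s : ℕ → ℝ}
  {μ : Measure (CurveClass ℂ)}

/-- **Endpoints (source).**  If the curves of the walks start within `ε` of `p` eventually, for
every `ε > 0`, then `μ`-a.e. class starts at `p`. [cite: BillingsleyCPM1999, Thm. 2.1 (portmanteau, closed sets)] -/
theorem ae_source_eq_of_ratio [IsProbabilityMeasure μ]
    (hne : ∀ᶠ n in atTop, Nonempty (HexMidEdgeSAW (Λ (s n)) (a (s n)) (b (s n))))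
    (hconv : ∀ f : CurveClass ℂ →ᵇ ℝ,
      Tendsto (fun n =>
        (∑ γ : HexMidEdgeSAW (Λ (s n)) (a (s n)) (b (s n)),
            hexCriticalFugacity ^ γ.length * f (CurveClass.mk ⟨polyline (γ.verts.map fun v => ((s n : ℝ) : ℂ) * hexCenter v)⟩)) /
          ∑ γ : HexMidEdgeSAW (Λ (s n)) (a (s n)) (b (s n)), hexCriticalFugacity ^ γ.length) atTop (𝓝 (∫ x, f x ∂μ)))
    {p : ℂ} (hsrc : ∀ ε : ℝ, 0 < ε → ∀ᶠ n in atTop,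
      ∀ γ : HexMidEdgeSAW (Λ (s n)) (a (s n)) (b (s n)),
        dist (CurveClass.mk ⟨polyline (γ.verts.map fun v => ((s n : ℝ) : ℂ) * hexCenter v)⟩).source p ≤ ε) :
    ∀ᵐ c ∂μ, c.source = p := by
  have hk : ∀ k : ℕ, ∀ᵐ c ∂μ, c ∈ {c : CurveClass ℂ | dist c.source p ≤ 1 / ((k : ℝ) + 1)} :=
    fun k => ae_mem_of_isClosed_of_ratio hne hconv
      (isClosed_le (CurveClass.continuous_source.dist continuous_const) continuous_const)
      (hsrc _ Nat.one_div_pos_of_nat)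
  filter_upwards [ae_all_iff.2 hk] with c hc
  have h0 : dist c.source p ≤ 0 :=
    ge_of_tendsto' tendsto_one_div_add_atTop_nhds_zero_nat fun k ↦ hc k
  exact dist_le_zero.1 h0

/-- **Endpoints (target).**  If the curves of the walks end within `ε` of `p` eventually, for
every `ε > 0`, then `μ`-a.e. class ends at `p`. [cite: BillingsleyCPM1999, Thm. 2.1 (portmanteau, closed sets)] -/
theorem ae_target_eq_of_ratio [IsProbabilityMeasure μ]
    (hne : ∀ᶠ n in atTop, Nonempty (HexMidEdgeSAW (Λ (s n)) (a (s n)) (b (s n))))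
    (hconv : ∀ f : CurveClass ℂ →ᵇ ℝ,
      Tendsto (fun n =>
        (∑ γ : HexMidEdgeSAW (Λ (s n)) (a (s n)) (b (s n)),
            hexCriticalFugacity ^ γ.length * f (CurveClass.mk ⟨polyline (γ.verts.map fun v => ((s n : ℝ) : ℂ) * hexCenter v)⟩)) /
          ∑ γ : HexMidEdgeSAW (Λ (s n)) (a (s n)) (b (s n)), hexCriticalFugacity ^ γ.length) atTop (𝓝 (∫ x, f x ∂μ)))
    {p : ℂ} (htgt : ∀ ε : ℝ, 0 < ε → ∀ᶠ n in atTop,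
      ∀ γ : HexMidEdgeSAW (Λ (s n)) (a (s n)) (b (s n)),
        dist (CurveClass.mk ⟨polyline (γ.verts.map fun v => ((s n : ℝ) : ℂ) * hexCenter v)⟩).target p ≤ ε) :
    ∀ᵐ c ∂μ, c.target = p := by
  have hk : ∀ k : ℕ, ∀ᵐ c ∂μ, c ∈ {c : CurveClass ℂ | dist c.target p ≤ 1 / ((k : ℝ) + 1)} :=
    fun k => ae_mem_of_isClosed_of_ratio hne hconv
      (isClosed_le (CurveClass.continuous_target.dist continuous_const) continuous_const)
      (htgt _ Nat.one_div_pos_of_nat)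
  filter_upwards [ae_all_iff.2 hk] with c hc
  have h0 : dist c.target p ≤ 0 :=
    ge_of_tendsto' tendsto_one_div_add_atTop_nhds_zero_nat fun k ↦ hc k
  exact dist_le_zero.1 h0

/-- **Confinement.**  If for every `ε > 0` the curves of the walks eventually lie in the closed
`ε`-neighbourhood of `Ω`, then `μ`-a.e. trace lies in `cl Ω`.
[cite: BillingsleyCPM1999, Thm. 2.1 (portmanteau, closed sets)] -/
theorem ae_range_subset_closure_of_ratio [IsProbabilityMeasure μ]
    (hne : ∀ᶠ n in atTop, Nonempty (HexMidEdgeSAW (Λ (s n)) (a (s n)) (b (s n))))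
    (hconv : ∀ f : CurveClass ℂ →ᵇ ℝ,
      Tendsto (fun n =>
        (∑ γ : HexMidEdgeSAW (Λ (s n)) (a (s n)) (b (s n)),
            hexCriticalFugacity ^ γ.length * f (CurveClass.mk ⟨polyline (γ.verts.map fun v => ((s n : ℝ) : ℂ) * hexCenter v)⟩)) /
          ∑ γ : HexMidEdgeSAW (Λ (s n)) (a (s n)) (b (s n)), hexCriticalFugacity ^ γ.length) atTop (𝓝 (∫ x, f x ∂μ)))
    {Ω : Set ℂ} (hconf : ∀ ε : ℝ, 0 < ε → ∀ᶠ n in atTop,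
      ∀ γ : HexMidEdgeSAW (Λ (s n)) (a (s n)) (b (s n)),
        (CurveClass.mk ⟨polyline (γ.verts.map fun v => ((s n : ℝ) : ℂ) * hexCenter v)⟩).range ⊆ cthickening ε Ω) :
    ∀ᵐ c ∂μ, c.range ⊆ closure Ω := by
  have hk : ∀ k : ℕ, ∀ᵐ c ∂μ,
      c ∈ CurveClass.rangeSubset (cthickening (1 / ((k : ℝ) + 1)) Ω) :=
    fun k => ae_mem_of_isClosed_of_ratio hne hconv
      (CurveClass.isClosed_rangeSubset isClosed_cthickening) (hconf _ Nat.one_div_pos_of_nat)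
  filter_upwards [ae_all_iff.2 hk] with c hc
  rw [closure_eq_iInter_cthickening, subset_iInter₂_iff]
  intro ε hε
  obtain ⟨k, hk⟩ := exists_nat_one_div_lt hε
  exact (show c.range ⊆ _ from hc k).trans (cthickening_mono hk.le _)

/-- **SIMPLICITY FROM A UNIFORM INJECTIVITY MODULUS ALONG THE SEQUENCE** (port of
`FloorRatio.ae_mem_simple_of_uniformModulus`).  If for every `ε, η > 0` there is `θ > 0` such that
eventually the `x_c`-mass of the walks whose curve is NOT in `CurveClass.modulusClass ε θ` is at
most `η` times the total mass, and `μ`-a.e. class has distinct endpoints, then `μ`-a.e. class is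
simple: `simple = {source ≠ target} ∩ ⋂ₙ ⋃ₘ modulusClass (1/(n+1)) (1/(m+1))`, the modulus events
are closed, and `μ(modulusClass εₙ θ) ≥ 1 - η` by the closed-set transfer.
[cite: AizenmanBurchard1999, §2.1 (the Borel space of curves; regularity passes to limits)] -/
theorem ae_mem_simple_of_ratio [IsProbabilityMeasure μ]
    (hne : ∀ᶠ n in atTop, Nonempty (HexMidEdgeSAW (Λ (s n)) (a (s n)) (b (s n))))
    (hconv : ∀ f : CurveClass ℂ →ᵇ ℝ,
      Tendsto (fun n =>
        (∑ γ : HexMidEdgeSAW (Λ (s n)) (a (s n)) (b (s n)),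
            hexCriticalFugacity ^ γ.length * f (CurveClass.mk ⟨polyline (γ.verts.map fun v => ((s n : ℝ) : ℂ) * hexCenter v)⟩)) /
          ∑ γ : HexMidEdgeSAW (Λ (s n)) (a (s n)) (b (s n)), hexCriticalFugacity ^ γ.length) atTop (𝓝 (∫ x, f x ∂μ)))
    (hends : ∀ᵐ c ∂μ, c.source ≠ c.target)
    (hmod : ∀ ε η : ℝ, 0 < ε → 0 < η → ∃ θ : ℝ, 0 < θ ∧ ∀ᶠ n in atTop,
      (∑ γ : HexMidEdgeSAW (Λ (s n)) (a (s n)) (b (s n)),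
          if CurveClass.mk ⟨polyline (γ.verts.map fun v => ((s n : ℝ) : ℂ) * hexCenter v)⟩ ∉ CurveClass.modulusClass ε θ
          then hexCriticalFugacity ^ γ.length else 0) ≤
        η * ∑ γ : HexMidEdgeSAW (Λ (s n)) (a (s n)) (b (s n)), hexCriticalFugacity ^ γ.length) :
    ∀ᵐ c ∂μ, c ∈ CurveClass.simple := by
  rw [CurveClass.simple_eq_iInter]
  have hmodk : ∀ n : ℕ, ∀ᵐ c ∂μ,
      c ∈ ⋃ m : ℕ, CurveClass.modulusClass (E := ℂ) (1 / (n + 1 : ℝ)) (1 / (m + 1 : ℝ)) := by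
    intro n
    set U : Set (CurveClass ℂ) :=
      ⋃ m : ℕ, CurveClass.modulusClass (1 / (n + 1 : ℝ)) (1 / (m + 1 : ℝ)) with hU
    have hUm : MeasurableSet U :=
      MeasurableSet.iUnion fun m ↦ CurveClass.measurableSet_modulusClass _ _
    -- `μ U ≥ 1 - η` for every `η`
    have hge : ∀ η : ℝ, 0 < η → ENNReal.ofReal (1 - η) ≤ μ U := by
      intro η hη
      obtain ⟨θ, hθ, hev⟩ := hmod (1 / (n + 1 : ℝ)) η (by positivity) hη
      obtain ⟨m, hm⟩ := exists_nat_one_div_lt hθ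
      have hsub : CurveClass.modulusClass (E := ℂ) (1 / (n + 1 : ℝ)) θ ⊆ U :=
        (CurveClass.modulusClass_mono le_rfl hm.le).trans
          (subset_iUnion (fun m : ℕ ↦
            CurveClass.modulusClass (E := ℂ) (1 / (n + 1 : ℝ)) (1 / (m + 1 : ℝ))) m)
      refine le_trans ?_ (measure_mono hsub)
      refine le_measure_of_isClosed_of_ratio hne hconv (CurveClass.isClosed_modulusClass _ _) ?_
      filter_upwards [hev, hne] with k hk hk'
      have hZ := dcsMass_pos hk'
      refine ENNReal.ofReal_le_ofReal ((le_div_iff₀ hZ).2 ?_)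
      -- mass inside = total - mass outside ≥ (1 - η) Z
      have hsplit : (∑ γ : HexMidEdgeSAW (Λ (s k)) (a (s k)) (b (s k)),
          if CurveClass.mk ⟨polyline (γ.verts.map fun v => ((s k : ℝ) : ℂ) * hexCenter v)⟩ ∈ CurveClass.modulusClass (1 / (n + 1 : ℝ)) θ
          then hexCriticalFugacity ^ γ.length else 0) +
          (∑ γ : HexMidEdgeSAW (Λ (s k)) (a (s k)) (b (s k)),
          if CurveClass.mk ⟨polyline (γ.verts.map fun v => ((s k : ℝ) : ℂ) * hexCenter v)⟩ ∉ CurveClass.modulusClass (1 / (n + 1 : ℝ)) θ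
          then hexCriticalFugacity ^ γ.length else 0) =
          ∑ γ : HexMidEdgeSAW (Λ (s k)) (a (s k)) (b (s k)), hexCriticalFugacity ^ γ.length := by
        rw [← Finset.sum_add_distrib]
        refine Finset.sum_congr rfl fun γ _ => ?_
        by_cases h : CurveClass.mk ⟨polyline (γ.verts.map fun v => ((s k : ℝ) : ℂ) * hexCenter v)⟩ ∈ CurveClass.modulusClass (1 / (n + 1 : ℝ)) θ
        · rw [if_pos h, if_neg (not_not.2 h), add_zero]
        · rw [if_neg h, if_pos h, zero_add]
      linarith
    have h1 : 1 ≤ μ U := by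
      have ht : Tendsto (fun η : ℝ => ENNReal.ofReal (1 - η)) (𝓝[>] 0) (𝓝 1) := by
        have : Tendsto (fun η : ℝ => 1 - η) (𝓝[>] 0) (𝓝 1) := by
          have h : Tendsto (fun η : ℝ => 1 - η) (𝓝 0) (𝓝 (1 - 0)) :=
            tendsto_const_nhds.sub tendsto_id
          rw [sub_zero] at h
          exact h.mono_left nhdsWithin_le_nhds
        have h' := ENNReal.tendsto_ofReal this
        rwa [ENNReal.ofReal_one] at h'
      exact le_of_tendsto ht (eventually_nhdsWithin_of_forall fun η hη => hge η hη)
    have h2 : μ U = 1 := le_antisymm prob_le_one h1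
    rw [ae_iff]
    change μ Uᶜ = 0
    rwa [prob_compl_eq_zero_iff hUm]
  filter_upwards [hends, ae_all_iff.2 hmodk] with c h1 h2
  exact ⟨h1, mem_iInter.2 h2⟩

end Consequences

/-! ### Registry form -/

/-- **Registered sub-goal `stub_twoPieceAdmIdentification_limits`** (crux item stmt-CriticalPhenomena-14005, line
`bridge-gate-renewal`, stub `stub_twoPieceAdmIdentification`): registry form of `ae_mem_simple_of_ratio` — simplicity of the limit classes from a uniform injectivity modulus along the sequence. [cite: AizenmanBurchard1999, §2.1 (the Borel space of curves; regularity passes to limits)] -/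
theorem stub_twoPieceAdmIdentification_limits :
    ∀ (Λ : ℝ → Finset HexVertex) (a b : ℝ → Sym2 HexVertex) (s : ℕ → ℝ)
      (μ : Measure (CurveClass ℂ)), IsProbabilityMeasure μ →
      (∀ᶠ n in atTop, Nonempty (HexMidEdgeSAW (Λ (s n)) (a (s n)) (b (s n)))) →
      (∀ f : CurveClass ℂ →ᵇ ℝ,
        Tendsto (fun n =>
          (∑ γ : HexMidEdgeSAW (Λ (s n)) (a (s n)) (b (s n)),
              hexCriticalFugacity ^ γ.length *
                f (CurveClass.mk ⟨polyline (γ.verts.map fun v => ((s n : ℝ) : ℂ) * hexCenter v)⟩)) /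
            (∑ γ : HexMidEdgeSAW (Λ (s n)) (a (s n)) (b (s n)), hexCriticalFugacity ^ γ.length))
          atTop (𝓝 (∫ x, f x ∂μ))) →
      (∀ᵐ c ∂μ, c.source ≠ c.target) →
      (∀ ε η : ℝ, 0 < ε → 0 < η → ∃ θ : ℝ, 0 < θ ∧ ∀ᶠ n in atTop,
        (∑ γ : HexMidEdgeSAW (Λ (s n)) (a (s n)) (b (s n)),
            if CurveClass.mk ⟨polyline (γ.verts.map fun v => ((s n : ℝ) : ℂ) * hexCenter v)⟩ ∉
                CurveClass.modulusClass ε θ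
            then hexCriticalFugacity ^ γ.length else 0) ≤
          η * ∑ γ : HexMidEdgeSAW (Λ (s n)) (a (s n)) (b (s n)), hexCriticalFugacity ^ γ.length) →
      ∀ᵐ c ∂μ, c ∈ CurveClass.simple :=
  fun Λ a b s μ hμ hne hconv hends hmod => by
    haveI := hμ
    exact ae_mem_simple_of_ratio hne hconv hends hmod

end Summit.CriticalPhenomena.SAWScalingLimit.Theorems.ObservableToSLER.TwoPiece

end
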